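import Summits.Ventures.LatticeQCDFlow.Exactness.IMHMultiProposalExact
import Summits.Ventures.LatticeQCDFlow.Exactness.RefreshScan
import HarnessLib

/-!
# Batching buys mixing: the multi-proposal flow sampler with `n` fresh proposals per update and a weight bounded by `W` satisfies the
# Doeblin minorisation `P(x, ·) ≥ (n/(2W + n − 1))·π` from EVERY state, hence `|μ₀Pᵗ(A) − π(A)| ≤ (1 − n/(2W + n − 1))ᵗ`

HONEST FRAMING: exact (Metropolis-corrected) sampling algorithms for lattice gauge theory;
figures of merit are autocorrelation/cost numbers at stated couplings and volumes; no
continuum-physics claim.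

Venture `LatticeQCDFlow` (cell pub-lqcd), topic `Exactness`; FANOUT row 30 (lean-1, GEN-41).  NEW WORK of the cell, sequel of GEN-41's
`IMHMultiProposalExact` (the pool-selection kernel `P` with `n` fresh proposals is exact for `π = w·q` on a general state space).  Here its
RATE, for a normalised weight bounded pointwise by `W` (`π = w·q` a probability law, `0 < w ≤ W`): from every state the one-step law dominates
`ε_n·π` with `ε_n = n/(2W + n − 1)` — increasing to `1` with the batch size, against `1/W` for the single-proposal sampler (Mengersen–Tweedie) —
and the tree's Doeblin lemma (`RefreshScan.uniformlyErgodic_of_minorised`) turns it into geometric convergence from every initial law.  Printed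
counterpart NAMED ONLY: Andrieu, Lee, Vihola, *Uniform ergodicity of the iterated conditional SMC and geometric ergodicity of particle Gibbs
samplers*, Bernoulli 24 (2018), Thm 1 (the i-SIR case), whose constant this is.

* §1 `lintegral_pi_coord_mul_eq` — `∫ f(z_j)·g(z_{−j}) dq^{⊗(m+1)} = (∫ f dq)(∫ g dq^{⊗m})` (independence of one coordinate from the rest,
  `piFinSuccAbove j`); `integral_coord_weight_eq`, `integral_sum_weight_eq` — `E[Σ_{i<m} w(b_i)] = m`.
* §2 **`inv_add_le_integral_inv_add_sum`** — JENSEN: `(c + m)⁻¹ ≤ E[(c + Σ_{i<m} w(b_i))⁻¹]` for `c > 0` (convexity of `s ↦ (c + s)⁻¹` on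
  `[0, ∞)`, Mathlib's `ConvexOn.map_integral_le`); `lintegral_inv_add_sum_ge` — its `ℝ≥0∞` form.
* §3 **`multiProposal_minorisation`** — for `n = m + 1 ≥ 1` proposals, every `x` and measurable `B`:
  `(m + 1)·ENNReal.ofReal((2W + m)⁻¹)·π(B) ≤ P(x, B)` (drop the current state's term; bound the pool weight by `2W + Σ_{i≠j} w(y_i)`; factorise;
  Jensen); `multiProposal_smul_le` — the measure form `ε_n • π ≤ P(x, ·)`.
* §4 **`multiProposal_uniformlyErgodic`** — `|μ₀Pᵗ(A) − π(A)| ≤ (1 − ε_n)ᵗ` for every initial law `μ₀`, every `t`, every set `A`, with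
  `ε_n = (m + 1)/(2W + m)` (invariance from `IMHMultiProposalExact.multiProposal_invariant`).
Reading (gauge files): proposing `n` gauge configurations per update and resampling one of the `n + 1` with probability `∝ e^{−S}/q̃` mixes, from
every start, at rate at least `n/(2W + n − 1)` per update when the normalised weight is bounded by `W` — `n ≈ 2W` proposals per update halve
the distance to the Wilson law at every step; the proposals of a batch are independent and can be generated in parallel.  NOT CLAIMED: the
every-weight (unbounded) analogue; sharpness of the constant; cost comparisons with `n` single-proposal updates (the tree's finite-state
`Scoring/MultiProposalRelaxationTime` has Yang–Liu's comparison).  No `sorry`, no new definitions, nothing cited as a fact.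
-/

noncomputable section

namespace Summit.Ventures.LatticeQCDFlow.Exactness

open MeasureTheory ProbabilityTheory Function Finset
open scoped ENNReal

variable {Ω : Type*} [MeasurableSpace Ω] {q : Measure Ω} [IsProbabilityMeasure q] {w : Ω → ℝ} {m : ℕ}

/-! ## §1 One coordinate against the rest -/

/-- **`∫ f(z_j)·g(z_{−j}) dq^{⊗(m+1)} = (∫ f dq)·(∫ g dq^{⊗m})`** for measurable `f, g ≥ 0` (`z_{−j} = (z_{j.succAbove i})_{i<m}`). [ours, bookkeeping] -/
theorem lintegral_pi_coord_mul_eq (q : Measure Ω) [IsProbabilityMeasure q] (m : ℕ) (j : Fin (m + 1)) {f : Ω → ℝ≥0∞}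
    {g : (Fin m → Ω) → ℝ≥0∞} (hf : Measurable f) (hg : Measurable g) :
    ∫⁻ z, f (z j) * g (fun i => z (j.succAbove i)) ∂(Measure.pi fun _ : Fin (m + 1) => q) =
      (∫⁻ a, f a ∂q) * ∫⁻ b, g b ∂(Measure.pi fun _ : Fin m => q) := by
  set e := MeasurableEquiv.piFinSuccAbove (fun _ : Fin (m + 1) => Ω) j with he
  have hmp : MeasurePreserving e.symm (q.prod (Measure.pi fun _ : Fin m => q)) (Measure.pi fun _ : Fin (m + 1) => q) :=
    (measurePreserving_piFinSuccAbove (fun _ : Fin (m + 1) => q) j).symm _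
  have hF : Measurable fun z : Fin (m + 1) → Ω => f (z j) * g (fun i => z (j.succAbove i)) :=
    (hf.comp (measurable_pi_apply j)).mul (hg.comp (measurable_pi_lambda _ fun i => measurable_pi_apply _))
  rw [← hmp.lintegral_comp hF, ← lintegral_prod_mul hf.aemeasurable hg.aemeasurable]
  refine lintegral_congr fun p => ?_
  simp [he, MeasurableEquiv.piFinSuccAbove_symm_apply, Fin.insertNth_apply_same, Fin.insertNth_apply_succAbove]

/-- `∫ w(b_i) dq^{⊗m}(b) = ∫ w dq` for every coordinate `i`. [ours, bookkeeping] -/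
theorem integral_coord_weight_eq (hw : Measurable w) (i : Fin m) :
    ∫ b, w (b i) ∂(Measure.pi fun _ : Fin m => q) = ∫ y, w y ∂q := by
  have hmp := MeasureTheory.measurePreserving_eval (fun _ : Fin m => q) i
  have h := integral_map (μ := Measure.pi fun _ : Fin m => q) (measurable_pi_apply i).aemeasurable (f := w)
    (hw.aestronglyMeasurable.mono_measure (le_of_eq hmp.map_eq))
  rw [hmp.map_eq] at h
  exact h.symm

/-- `E[Σ_{i<m} w(b_i)] = m·∫ w dq` under `q^{⊗m}` for a bounded measurable weight. [ours, bookkeeping] -/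
theorem integral_sum_weight_eq (hw : Measurable w) {C : ℝ} (hwC : ∀ y, |w y| ≤ C) :
    ∫ b, ∑ i, w (b i) ∂(Measure.pi fun _ : Fin m => q) = m * ∫ y, w y ∂q := by
  rw [integral_finsetSum _ fun i _ => ?_]
  · simp_rw [integral_coord_weight_eq hw]
    rw [sum_const, card_univ, Fintype.card_fin, nsmul_eq_mul]
  · exact Integrable.of_bound ((hw.comp (measurable_pi_apply i)).aestronglyMeasurable) C
      (ae_of_all _ fun b => by rw [Real.norm_eq_abs]; exact hwC _)

/-! ## §2 Jensen for `s ↦ (c + s)⁻¹` -/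

/-- `s ↦ (c + s)⁻¹` is convex on `[0, ∞)` for `c > 0`. [folklore] -/
theorem convexOn_inv_const_add {c : ℝ} (hc : 0 < c) : ConvexOn ℝ (Set.Ici 0) (fun s : ℝ => (c + s)⁻¹) := by
  have h := (convexOn_zpow (-1 : ℤ) : ConvexOn ℝ (Set.Ioi (0 : ℝ)) fun x : ℝ => x ^ (-1 : ℤ)).translate_right c
  have hsub : Set.Ici (0 : ℝ) ⊆ (fun z => c + z) ⁻¹' Set.Ioi 0 := fun s hs => by
    simp only [Set.mem_preimage, Set.mem_Ioi]; exact add_pos_of_pos_of_nonneg hc hs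
  have h2 := h.subset hsub (convex_Ici 0)
  refine ⟨convex_Ici 0, fun x hx y hy a' b' ha' hb' hab => ?_⟩
  have := h2.2 hx hy ha' hb' hab
  simpa only [Function.comp, zpow_neg_one] using this

/-- **JENSEN: `(c + m·∫w)⁻¹ ≤ E[(c + Σ_{i<m} w(b_i))⁻¹]`** under `q^{⊗m}` for `c > 0` and a measurable weight `0 ≤ w ≤ W`. [ours] -/
theorem inv_add_le_integral_inv_add_sum (hw : Measurable w) (hw0 : ∀ y, 0 ≤ w y) {W : ℝ} (hwW : ∀ y, w y ≤ W) {c : ℝ} (hc : 0 < c) :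
    (c + m * ∫ y, w y ∂q)⁻¹ ≤ ∫ b, (c + ∑ i, w (b i))⁻¹ ∂(Measure.pi fun _ : Fin m => q) := by
  set μ : Measure (Fin m → Ω) := Measure.pi fun _ : Fin m => q with hμ
  have hwC : ∀ y, |w y| ≤ W := fun y => by rw [abs_of_nonneg (hw0 y)]; exact hwW y
  have hSm : Measurable fun b : Fin m → Ω => ∑ i, w (b i) := Finset.measurable_sum _ fun i _ => hw.comp (measurable_pi_apply i)
  have hS0 : ∀ b : Fin m → Ω, 0 ≤ ∑ i, w (b i) := fun b => sum_nonneg fun i _ => hw0 _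
  have hSi : Integrable (fun b : Fin m → Ω => ∑ i, w (b i)) μ :=
    Integrable.of_bound hSm.aestronglyMeasurable (m * W) (ae_of_all _ fun b => by
      rw [Real.norm_eq_abs, abs_of_nonneg (hS0 b)]
      calc ∑ i, w (b i) ≤ ∑ _i : Fin m, W := sum_le_sum fun i _ => hwW _
        _ = m * W := by rw [sum_const, card_univ, Fintype.card_fin, nsmul_eq_mul])
  have hφi : Integrable ((fun s : ℝ => (c + s)⁻¹) ∘ fun b : Fin m → Ω => ∑ i, w (b i)) μ :=
    Integrable.of_bound ((measurable_const.add hSm).inv.aestronglyMeasurable) c⁻¹ (ae_of_all _ fun b => by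
      simp only [Function.comp, Real.norm_eq_abs]
      have hpos : 0 < c + ∑ i, w (b i) := add_pos_of_pos_of_nonneg hc (hS0 b)
      rw [abs_of_pos (inv_pos.2 hpos)]
      exact inv_anti₀ hc (le_add_of_nonneg_right (hS0 b)))
  have hcont : ContinuousOn (fun s : ℝ => (c + s)⁻¹) (Set.Ici 0) :=
    ContinuousOn.inv₀ (continuousOn_const.add continuousOn_id) fun s hs => ne_of_gt (add_pos_of_pos_of_nonneg hc hs)
  have hJ := (convexOn_inv_const_add hc).map_integral_le hcont isClosed_Ici (ae_of_all _ fun b => hS0 b) hSi hφi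
  rw [integral_sum_weight_eq hw hwC] at hJ
  exact hJ

/-- The `ℝ≥0∞` form: `ENNReal.ofReal (c + m)⁻¹ ≤ ∫⁻ b, (ENNReal.ofReal c + Σ_i ENNReal.ofReal (w(b_i)))⁻¹ dq^{⊗m}` for a normalised weight. [ours] -/
theorem lintegral_inv_add_sum_ge (hw : Measurable w) (hw0 : ∀ y, 0 ≤ w y) {W : ℝ} (hwW : ∀ y, w y ≤ W) (h1 : ∫ y, w y ∂q = 1) {c : ℝ}
    (hc : 0 < c) :
    ENNReal.ofReal (c + m)⁻¹ ≤ ∫⁻ b, (ENNReal.ofReal c + ∑ i, ENNReal.ofReal (w (b i)))⁻¹ ∂(Measure.pi fun _ : Fin m => q) := by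
  set μ : Measure (Fin m → Ω) := Measure.pi fun _ : Fin m => q with hμ
  have hS0 : ∀ b : Fin m → Ω, 0 ≤ ∑ i, w (b i) := fun b => sum_nonneg fun i _ => hw0 _
  have hSm : Measurable fun b : Fin m → Ω => ∑ i, w (b i) := Finset.measurable_sum _ fun i _ => hw.comp (measurable_pi_apply i)
  -- the integrand is `ofReal ((c + S)⁻¹)`
  have hpt : ∀ b : Fin m → Ω, (ENNReal.ofReal c + ∑ i, ENNReal.ofReal (w (b i)))⁻¹ = ENNReal.ofReal ((c + ∑ i, w (b i))⁻¹) := by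
    intro b
    rw [← ENNReal.ofReal_sum_of_nonneg (fun i _ => hw0 _), ← ENNReal.ofReal_add hc.le (hS0 b),
      ENNReal.ofReal_inv_of_pos (add_pos_of_pos_of_nonneg hc (hS0 b))]
  simp_rw [hpt]
  have hgi : Integrable (fun b : Fin m → Ω => (c + ∑ i, w (b i))⁻¹) μ :=
    Integrable.of_bound ((measurable_const.add hSm).inv.aestronglyMeasurable) c⁻¹ (ae_of_all _ fun b => by
      rw [Real.norm_eq_abs]
      have hpos : 0 < c + ∑ i, w (b i) := add_pos_of_pos_of_nonneg hc (hS0 b)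
      rw [abs_of_pos (inv_pos.2 hpos)]
      exact inv_anti₀ hc (le_add_of_nonneg_right (hS0 b)))
  rw [← ofReal_integral_eq_lintegral_ofReal hgi (ae_of_all _ fun b => inv_nonneg.2 (add_pos_of_pos_of_nonneg hc (hS0 b)).le)]
  refine ENNReal.ofReal_le_ofReal ?_
  have h := inv_add_le_integral_inv_add_sum (q := q) (m := m) hw hw0 hwW hc
  rwa [h1, mul_one] at h

/-! ## §3 The minorisation from every state -/

/-- **`P(x, B) ≥ (m + 1)·(2W + m)⁻¹·π(B)` FROM EVERY STATE** for the pool-selection kernel with `m + 1` fresh proposals, a measurable weight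
`0 < w ≤ W` with `π = w·q` a probability law, every `x` and every measurable `B`. [ours] -/
theorem multiProposal_minorisation (hw : Measurable w) (hw0 : ∀ y, 0 < w y) {W : ℝ} (hwW : ∀ y, w y ≤ W)
    [IsProbabilityMeasure (q.withDensity fun y => ENNReal.ofReal (w y))] (P : Kernel Ω Ω)
    (hP : ∀ (x : Ω) {B : Set Ω}, MeasurableSet B → P x B = ∫⁻ y, (∑ j, ENNReal.ofReal (w (Fin.cons (α := fun _ : Fin (m + 2) => Ω) x y j)) *
      B.indicator (fun _ => (1 : ℝ≥0∞)) (Fin.cons (α := fun _ : Fin (m + 2) => Ω) x y j)) /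
      (∑ i, ENNReal.ofReal (w (Fin.cons (α := fun _ : Fin (m + 2) => Ω) x y i))) ∂(Measure.pi fun _ : Fin (m + 1) => q))
    (x : Ω) {B : Set Ω} (hB : MeasurableSet B) :
    ((m + 1 : ℕ) : ℝ≥0∞) * ENNReal.ofReal (2 * W + m)⁻¹ * (q.withDensity fun y => ENNReal.ofReal (w y)) B ≤ P x B := by
  set π : Measure Ω := q.withDensity fun y => ENNReal.ofReal (w y) with hπ
  set μ : Measure (Fin (m + 1) → Ω) := Measure.pi fun _ : Fin (m + 1) => q with hμ
  have hWpos : 0 < W := by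
    obtain ⟨y⟩ := nonempty_of_isProbabilityMeasure q
    exact (hw0 y).trans_le (hwW y)
  have h1 : ∫ y, w y ∂q = 1 := by
    have hl : ∫⁻ y, ENNReal.ofReal (w y) ∂q = 1 := by
      have := (measure_univ : π Set.univ = 1)
      rwa [hπ, withDensity_apply _ MeasurableSet.univ, Measure.restrict_univ] at this
    rw [integral_eq_lintegral_of_nonneg_ae (ae_of_all _ fun y => (hw0 y).le) hw.aestronglyMeasurable, hl, ENNReal.toReal_one]
  -- the `j`-th lower-bound integrand: `f(y_j)·g(y_{−j})`
  set f : Ω → ℝ≥0∞ := fun y => ENNReal.ofReal (w y) * B.indicator (fun _ => (1 : ℝ≥0∞)) y with hf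
  set g : (Fin m → Ω) → ℝ≥0∞ := fun b => (ENNReal.ofReal (2 * W) + ∑ i, ENNReal.ofReal (w (b i)))⁻¹ with hg
  have hfm : Measurable f := hw.ennreal_ofReal.mul (measurable_const.indicator hB)
  have hgm : Measurable g := (measurable_const.add (Finset.measurable_sum _ fun i _ => hw.ennreal_ofReal.comp (measurable_pi_apply i))).inv
  have hfint : ∫⁻ a, f a ∂q = π B := by
    have : f = B.indicator fun y => ENNReal.ofReal (w y) := by
      funext y; by_cases hy : y ∈ B <;> simp [hf, hy]
    rw [this, lintegral_indicator hB, hπ, withDensity_apply _ hB]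
  have hgint : ENNReal.ofReal (2 * W + m)⁻¹ ≤ ∫⁻ b, g b ∂(Measure.pi fun _ : Fin m => q) :=
    lintegral_inv_add_sum_ge hw (fun y => (hw0 y).le) hwW h1 (by positivity)
  -- pointwise lower bound of the pool integrand by the sum of the `m + 1` factorised terms
  have hpt : ∀ y : Fin (m + 1) → Ω, ∑ j : Fin (m + 1), f (y j) * g (fun i => y (j.succAbove i)) ≤
      (∑ j, ENNReal.ofReal (w (Fin.cons (α := fun _ : Fin (m + 2) => Ω) x y j)) *
        B.indicator (fun _ => (1 : ℝ≥0∞)) (Fin.cons (α := fun _ : Fin (m + 2) => Ω) x y j)) /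
      (∑ i, ENNReal.ofReal (w (Fin.cons (α := fun _ : Fin (m + 2) => Ω) x y i))) := by
    intro y
    set D := ∑ i, ENNReal.ofReal (w (Fin.cons (α := fun _ : Fin (m + 2) => Ω) x y i)) with hD
    -- drop the current state's term and split the division over the proposals
    have hR : (∑ j, ENNReal.ofReal (w (Fin.cons (α := fun _ : Fin (m + 2) => Ω) x y j)) *
        B.indicator (fun _ => (1 : ℝ≥0∞)) (Fin.cons (α := fun _ : Fin (m + 2) => Ω) x y j)) = f x + ∑ j : Fin (m + 1), f (y j) := by
      rw [Fin.sum_univ_succ]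
      simp only [Fin.cons_zero, Fin.cons_succ, hf]
    have hnum : ∑ j : Fin (m + 1), f (y j) / D ≤ (∑ j, ENNReal.ofReal (w (Fin.cons (α := fun _ : Fin (m + 2) => Ω) x y j)) *
        B.indicator (fun _ => (1 : ℝ≥0∞)) (Fin.cons (α := fun _ : Fin (m + 2) => Ω) x y j)) / D := by
      rw [hR]
      simp only [div_eq_mul_inv, ← Finset.sum_mul]
      exact mul_le_mul' le_add_self le_rfl
    refine le_trans (sum_le_sum fun j _ => ?_) hnum
    -- `D ≤ 2W + S_{−j}` gives `f(y_j)·g(y_{−j}) ≤ f(y_j)/D`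
    have hDle : D ≤ ENNReal.ofReal (2 * W) + ∑ i, ENNReal.ofReal (w (y (j.succAbove i))) := by
      rw [hD, Fin.sum_univ_succ, Fin.sum_univ_succAbove _ j]
      simp only [Fin.cons_zero, Fin.cons_succ]
      rw [← add_assoc, show ENNReal.ofReal (2 * W) = ENNReal.ofReal W + ENNReal.ofReal W from by
        rw [← ENNReal.ofReal_add hWpos.le hWpos.le, two_mul]]
      exact add_le_add (add_le_add (ENNReal.ofReal_le_ofReal (hwW x)) (ENNReal.ofReal_le_ofReal (hwW _))) le_rfl
    rw [hg, div_eq_mul_inv]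
    exact mul_le_mul' le_rfl (ENNReal.inv_le_inv.2 hDle)
  -- integrate
  have hmeas : ∀ j : Fin (m + 1), Measurable fun y : Fin (m + 1) → Ω => f (y j) * g (fun i => y (j.succAbove i)) := fun j =>
    (hfm.comp (measurable_pi_apply j)).mul (hgm.comp (measurable_pi_lambda _ fun i => measurable_pi_apply _))
  calc ((m + 1 : ℕ) : ℝ≥0∞) * ENNReal.ofReal (2 * W + m)⁻¹ * π B
      = ∑ _j : Fin (m + 1), π B * ENNReal.ofReal (2 * W + m)⁻¹ := by
        rw [sum_const, card_univ, Fintype.card_fin, nsmul_eq_mul]; ring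
    _ ≤ ∑ j : Fin (m + 1), (∫⁻ a, f a ∂q) * ∫⁻ b, g b ∂(Measure.pi fun _ : Fin m => q) :=
        sum_le_sum fun j _ => by rw [hfint]; exact mul_le_mul' le_rfl hgint
    _ = ∑ j : Fin (m + 1), ∫⁻ y, f (y j) * g (fun i => y (j.succAbove i)) ∂μ :=
        sum_congr rfl fun j _ => (lintegral_pi_coord_mul_eq q m j hfm hgm).symm
    _ = ∫⁻ y, ∑ j : Fin (m + 1), f (y j) * g (fun i => y (j.succAbove i)) ∂μ := (lintegral_finsetSum _ fun j _ => hmeas j).symm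
    _ ≤ ∫⁻ y, (∑ j, ENNReal.ofReal (w (Fin.cons (α := fun _ : Fin (m + 2) => Ω) x y j)) *
          B.indicator (fun _ => (1 : ℝ≥0∞)) (Fin.cons (α := fun _ : Fin (m + 2) => Ω) x y j)) /
        (∑ i, ENNReal.ofReal (w (Fin.cons (α := fun _ : Fin (m + 2) => Ω) x y i))) ∂μ := lintegral_mono hpt
    _ = P x B := (hP x hB).symm

/-- **THE MEASURE FORM**: `ε • π ≤ P(x, ·)` with `ε = (m + 1)·(2W + m)⁻¹`. [ours] -/
theorem multiProposal_smul_le (hw : Measurable w) (hw0 : ∀ y, 0 < w y) {W : ℝ} (hwW : ∀ y, w y ≤ W)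
    [IsProbabilityMeasure (q.withDensity fun y => ENNReal.ofReal (w y))] (P : Kernel Ω Ω)
    (hP : ∀ (x : Ω) {B : Set Ω}, MeasurableSet B → P x B = ∫⁻ y, (∑ j, ENNReal.ofReal (w (Fin.cons (α := fun _ : Fin (m + 2) => Ω) x y j)) *
      B.indicator (fun _ => (1 : ℝ≥0∞)) (Fin.cons (α := fun _ : Fin (m + 2) => Ω) x y j)) /
      (∑ i, ENNReal.ofReal (w (Fin.cons (α := fun _ : Fin (m + 2) => Ω) x y i))) ∂(Measure.pi fun _ : Fin (m + 1) => q))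
    (x : Ω) :
    (((m + 1 : ℕ) : ℝ≥0∞) * ENNReal.ofReal (2 * W + m)⁻¹) • (q.withDensity fun y => ENNReal.ofReal (w y)) ≤ P x := by
  refine Measure.le_iff.2 fun B hB => ?_
  rw [Measure.smul_apply, smul_eq_mul]
  exact multiProposal_minorisation hw hw0 hwW P hP x hB

/-! ## §4 Geometric convergence from every start -/

/-- **BATCHING BUYS MIXING**: for every initial law `μ₀`, every `t` and every set `A`,
`|μ₀Pᵗ(A) − π(A)| ≤ (1 − (m + 1)/(2W + m))ᵗ` — the pool-selection flow sampler with `m + 1` proposals per update and a weight bounded by `W`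
is uniformly ergodic at a rate that tends to one with the batch size. [ours] -/
theorem multiProposal_uniformlyErgodic (hw : Measurable w) (hw0 : ∀ y, 0 < w y) {W : ℝ} (hwW : ∀ y, w y ≤ W)
    [IsProbabilityMeasure (q.withDensity fun y => ENNReal.ofReal (w y))] (P : Kernel Ω Ω)
    (hP : ∀ (x : Ω) {B : Set Ω}, MeasurableSet B → P x B = ∫⁻ y, (∑ j, ENNReal.ofReal (w (Fin.cons (α := fun _ : Fin (m + 2) => Ω) x y j)) *
      B.indicator (fun _ => (1 : ℝ≥0∞)) (Fin.cons (α := fun _ : Fin (m + 2) => Ω) x y j)) /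
      (∑ i, ENNReal.ofReal (w (Fin.cons (α := fun _ : Fin (m + 2) => Ω) x y i))) ∂(Measure.pi fun _ : Fin (m + 1) => q))
    (μ₀ : Measure Ω) [IsProbabilityMeasure μ₀] (t : ℕ) (A : Set Ω) :
    |((fun ν : Measure Ω => ν.bind P)^[t] μ₀).real A - (q.withDensity fun y => ENNReal.ofReal (w y)).real A| ≤
      (1 - (m + 1) / (2 * W + m)) ^ t := by
  set π : Measure Ω := q.withDensity fun y => ENNReal.ofReal (w y) with hπ
  haveI : IsMarkovKernel P := ⟨fun x => ⟨multiProposal_apply_univ hw0 P hP x⟩⟩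
  have hinv : Kernel.Invariant P π := by
    show π.bind P = π
    ext B hB
    rw [Measure.bind_apply hB (Kernel.aemeasurable _)]
    exact multiProposal_invariant hw hw0 P hP hB
  have hWpos : 0 < W := by
    obtain ⟨y⟩ := nonempty_of_isProbabilityMeasure q
    exact (hw0 y).trans_le (hwW y)
  have h := uniformlyErgodic_of_minorised (multiProposal_smul_le hw hw0 hwW P hP) hinv μ₀ t A
  have hε : (((m + 1 : ℕ) : ℝ≥0∞) * ENNReal.ofReal (2 * W + m)⁻¹).toReal = (m + 1) / (2 * W + m) := by
    rw [ENNReal.toReal_mul, ENNReal.toReal_natCast, ENNReal.toReal_ofReal (inv_nonneg.2 (by positivity)), div_eq_mul_inv]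
    push_cast; ring
  rwa [hε] at h

end Summit.Ventures.LatticeQCDFlow.Exactness
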